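import Literature.NumberTheory.EllipticCurves.HeegnerPointsKolyvaginProp82Proofs
import Literature.NumberTheory.EllipticCurves.HeegnerPointsKolyvaginPairingMap
import HarnessLib

/-!
# Gross's Prop. 8.2 at an inert Kolyvagin prime WITHOUT eigenlines: an endomorphism of `E[p]` with
# no eigenvector replaces the `±`-decomposition (any prime `p`, in particular `p = 2`)

Toward leaf (L2A/B) of VARIANT K (crux `UpperOffV0HSYPlus`, stmt-BirchSwinnertonDyer-19804) at
`p = 2`: the binders `hL2A` / `hL2B` of
`SylvesterTwoCoupledDescentAtTwo.selmerGroup_eq_bot_and_le_closure_of_coupledLeaves` are Gross 1991,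
Prop. 8.2 — "if `d` is Selmer away from the Kolyvagin prime `λ` and NOT Selmer at `λ`, then every
Selmer class is locally trivial at `λ`" — with the `ν/τ` eigen-clause deleted. The tree's
`Gross1991_prop_8_2_at_of_reciprocity` (`HeegnerPointsKolyvaginProp82Proofs`) proves Prop. 8.2 from
Kolyvagin's reciprocity (R) for `p ≠ 2` and `±`-EIGENclasses `s, d` of complex conjugation: the last
step is "the two eigenlines of `E_p` meet in `0` since `p` is odd". At `p = 2` there are no signs.

THIS FILE proves the same conclusion, for ANY prime `p`, with the eigen-hypotheses replaced by an
additive `Γ_K`-equivariant endomorphism `fn` of `E[p] = E(K̄)[p]` WITHOUT EIGENVECTOR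
(`fn t = k • t ⇒ t = 0`; for a `j = 0` curve over `K ∋ ω` and `p = 2`: `fn = [ζ]|E[2]`,
`fn² + fn + 1 = 0`) and reciprocity (R) assumed for BOTH pairs `(s, d)` and `(s, H¹(fn) d)`:
`mem_torsionLocalKer_of_reciprocity_of_noEigenvector`. Proof: Steps 0–2, 7, 9 of the tree proof
re-run verbatim (a Frobenius `τ'` at `𝔔 ∣ λ` fixing `E_p`; the tame homomorphism
`a = [d, ·]|_{I_𝔔}` with cyclic image generated by some `a σ₁ ≠ 0`; Prop. 9.6
`s_λ = 0 ⟺ [s, τ'] = 0`); NEW Step 8: (R), (R') and `[H¹(fn) d, σ] = fn [d, σ]`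
(`h1Eval_resH1Hom_id`) put `x = [s, τ']` in `ℤ·t ∩ ℤ·(fn t)` (`t = a σ₁`,
`mem_zmultiples_of_pairing_eq_zero`), and `ℤ·t ∩ ℤ·(fn t) = 0` because `fn` has no eigenvector
(`eq_zero_of_mem_zmultiples_of_noEigenvector`). No parity of `p`, no sign, no complex conjugation on
classes. Theorem-only; nothing asserted on 19804; no label moves; BSD not claimed for any curve.
Credit: Steps 0–2/7/9 are the tree's (file `HeegnerPointsKolyvaginProp82Proofs`, Gross 1991 §§7–9).

References: B. H. Gross, *Kolyvagin's work on modular elliptic curves* (1991), Prop. 8.1, 8.2, (7.1),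
(7.6), Prop. 9.6 [GrossLMS1991]; W. G. McCallum, *Kolyvagin's work on Shafarevich–Tate groups* (1991),
Prop. 2.2, Lemma 5.3 [McCallumLMS1991].
-/

set_option linter.dupNamespace false -- Summits modules are `Summit.<Summit>.<Problem>…` by design

noncomputable section

open scoped Classical Pointwise
open WeierstrassCurve NumberField IsDedekindDomain Field WithZero
open Literature.NumberTheory.EllipticCurves Literature.NumberTheory.GaloisRepresentations
open Literature.NumberTheory.EllipticCurves.KolyvaginReciprocity

universe u

namespace Summit.BirchSwinnertonDyer.BirchSwinnertonDyer.Theorems.SylvesterTwoCoupledDuality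

/-! ## The linear algebra: two lines through an endomorphism without eigenvector meet in `0` -/

section LinearAlgebra

variable {T : Type*} [AddCommGroup T]

/-- **`ℤ·t ∩ ℤ·(fn t) = 0` when `fn` has no eigenvector** on a group killed by the prime `p`:
if `x = i • t = j • fn t` with `x ≠ 0` then `p ∤ j`, and with `m j ≡ 1 (p)`,
`fn t = (m j) • fn t = (m i) • t` exhibits `t ≠ 0` as an eigenvector. [folklore] -/
theorem eq_zero_of_mem_zmultiples_of_noEigenvector {p : ℕ} (hp : p.Prime)
    (hpT : ∀ t : T, p • t = 0) (fn : T →+ T) (hnoeig : ∀ (t : T) (k : ℤ), fn t = k • t → t = 0)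
    {t x : T} (hx : x ∈ AddSubgroup.zmultiples t) (hx' : x ∈ AddSubgroup.zmultiples (fn t)) :
    x = 0 := by
  by_contra hx0
  obtain ⟨i, rfl⟩ := AddSubgroup.mem_zmultiples_iff.mp hx
  obtain ⟨j, hj⟩ := AddSubgroup.mem_zmultiples_iff.mp hx'
  have hpT' : ∀ u : T, (p : ℤ) • u = 0 := fun u ↦ by rw [natCast_zsmul]; exact hpT u
  -- `p ∤ j`
  have hpj : ¬ (p : ℤ) ∣ j := by
    rintro ⟨r, rfl⟩
    apply hx0
    rw [← hj, mul_zsmul, hpT']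
  -- Bézout: `r p + m j = 1`
  have hcopN : Nat.Coprime p j.natAbs :=
    (Nat.Prime.coprime_iff_not_dvd hp).mpr fun h ↦ hpj (Int.natCast_dvd.mpr h)
  have hcop : IsCoprime (p : ℤ) j := by
    rw [Int.isCoprime_iff_gcd_eq_one, Int.gcd_eq_natAbs]
    simpa using hcopN
  obtain ⟨r, m, hmr⟩ := hcop
  -- `fn t = (m * j) • fn t = m • x = (m * i) • t`: an eigenvector
  have hfnt : fn t = (m * i) • t := by
    have h1 : (r * p + m * j) • fn t = fn t := by rw [hmr, one_zsmul]
    rw [add_zsmul, mul_zsmul, hpT', zsmul_zero, zero_add, mul_zsmul, hj, ← mul_zsmul] at h1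
    exact h1.symm
  exact hx0 (by rw [hnoeig t (m * i) hfnt, zsmul_zero])

end LinearAlgebra

/-! ## Prop. 8.2 from (R), (R') and an endomorphism without eigenvector -/

section Main

variable {K : Type u} [Field K] [NumberField K] (W : WeierstrassCurve ℚ)

/-- **Gross 1991, Prop. 8.2 at a Kolyvagin prime, from Kolyvagin reciprocity, WITHOUT eigenlines.**
Let `E/ℚ` be elliptic (`W`), `K` imaginary quadratic, `p` ANY prime, `ℓ` a Kolyvagin prime for
`(E, K, p)` (`IsKolyvaginPrime`: `ℓ ∤ NDp`, `λ = (ℓ)` inert, `Frob(ℓ) = Frob(∞)` on `K(E_p)`) with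
`E/K` of good reduction at `λ`; `e` a biadditive alternating left-non-degenerate pairing on
`E_p = E(K̄)[p]`; `fn` an additive `Γ_K`-equivariant endomorphism of `E_p` WITHOUT EIGENVECTOR
(`fn t = k • t ⇒ t = 0`). Let `d ∈ H¹(K, E_p)` fail the Selmer condition at `λ` and `s ∈ Sel(E/K)_p`.
**Assume (R) for `(s, d)` and (R') for `(s, H¹(fn) d)`:** for every prime `𝔔 ∣ λ` of `\bar ℤ_K`,
every arithmetic Frobenius `F` at `𝔔` fixing `E_p` and every `σ ∈ I_𝔔`,
`e([s, F], [d, σ]) = 0 = e([s, F], [H¹(fn) d, σ])`. **Then `s_λ = 0`** (`torsionLocalKer`).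
Proof: Steps 0–2, 7, 9 of the tree's `Gross1991_prop_8_2_at_of_reciprocity` (Frobenius `τ'` at
`𝔔 ∣ λ` fixing `E_p`; tame homomorphism `a = [d, ·]|I_𝔔` with cyclic image `ℤ·a σ₁`, `a σ₁ ≠ 0`
by (7.1); Prop. 9.6); then `x = [s, τ'] ∈ ℤ·a σ₁ ∩ ℤ·fn (a σ₁) = 0`
(`mem_zmultiples_of_pairing_eq_zero` twice, `[H¹(fn) d, σ] = fn [d, σ]`,
`eq_zero_of_mem_zmultiples_of_noEigenvector`). [cite: GrossLMS1991, Prop. 8.2 (proof), Prop. 8.1, (7.1), (7.6), Prop. 9.6] -/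
theorem mem_torsionLocalKer_of_reciprocity_of_noEigenvector [W.IsElliptic]
    (hK : IsImaginaryQuadratic K) {p : ℕ} (hp : p.Prime)
    {N ℓ : ℕ} (hℓ : IsKolyvaginPrime N W K p ℓ)
    (hgood : (W.baseChange K).HasGoodReductionAt hℓ.place)
    {A : Type*} [AddCommGroup A]
    (e : geomTorsion (W.baseChange K) p →+ geomTorsion (W.baseChange K) p →+ A)
    (halt : ∀ x, e x x = 0) (hnd : ∀ x, (∀ y, e x y = 0) → x = 0)
    (fn : geomTorsion (W.baseChange K) p →+ geomTorsion (W.baseChange K) p)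
    (hfn : ∀ (g : absoluteGaloisGroup K) (P : geomTorsion (W.baseChange K) p),
      fn (ContinuousMonoidHom.id _ g • P) = g • fn P)
    (hnoeig : ∀ (t : geomTorsion (W.baseChange K) p) (k : ℤ), fn t = k • t → t = 0)
    {d : galH1Torsion (W.baseChange K) p}
    (hdv : d ∉ selmerLocalKer (W.baseChange K) (hℓ.place.adicCompletion K) p)
    {s : galH1Torsion (W.baseChange K) p} (hs : s ∈ selmerGroup (W.baseChange K) p)
    (hR : ∀ 𝔔 ∈ hℓ.place.primesAbove, ∀ F : absoluteGaloisGroup K, IsArithFrobAt (𝓞 K) F 𝔔 →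
      F ∈ torsionFixing (W.baseChange K) p → ∀ σ ∈ 𝔔.inertia (absoluteGaloisGroup K),
      e (h1Eval (W.baseChange K) p s F) (h1Eval (W.baseChange K) p d σ) = 0)
    (hR' : ∀ 𝔔 ∈ hℓ.place.primesAbove, ∀ F : absoluteGaloisGroup K, IsArithFrobAt (𝓞 K) F 𝔔 →
      F ∈ torsionFixing (W.baseChange K) p → ∀ σ ∈ 𝔔.inertia (absoluteGaloisGroup K),
      e (h1Eval (W.baseChange K) p s F)
        (h1Eval (W.baseChange K) p (resH1Hom (ContinuousMonoidHom.id _) fn hfn d) σ) = 0) :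
    s ∈ (W.baseChange K).torsionLocalKer (hℓ.place.adicCompletion K) p := by
  -- adapted from Literature/NumberTheory/EllipticCurves/HeegnerPointsKolyvaginProp82Proofs.lean
  -- (`Gross1991_prop_8_2_at_of_reciprocity`, Steps 0–2, 7, 9 verbatim; Step 8 replaced)
  classical
  haveI : Fact p.Prime := ⟨hp⟩
  haveI : Algebra.IsQuadraticExtension ℚ K := ⟨hK.1⟩
  haveI : IsTotallyComplex K := hK.2
  set w := hℓ.place with hwdef
  have hℓprime : ℓ.Prime := hℓ.prime
  have hp0 : (p : ℤ) ≠ 0 := by exact_mod_cast hp.ne_zero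
  -- ### Step 0: `p ∉ λ`, `λ` good, `v_λ(ℓ) = 1`, `#E_p = p²`, `p E_p = 0`
  have hpw' : (p : 𝓞 K) ∉ w.asIdeal :=
    not_natCast_mem_of_prime_ne hℓprime hp hℓ.2.2.2.1 w hℓ.mem_place
  have hpw : (((p : ℕ) : ℤ) : 𝓞 K) ∉ w.asIdeal := by rwa [Int.cast_natCast]
  have hwbad : w ∉ (W.baseChange K).badPlaces (𝓞 K) := fun h ↦ h hgood
  have hπ : w.valuation K (ℓ : K) = exp (-1 : ℤ) := by
    have h1 : (ℓ : K) = algebraMap (𝓞 K) K (ℓ : 𝓞 K) := by simp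
    rw [h1, HeightOneSpectrum.valuation_of_algebraMap]
    exact w.intValuation_singleton (by exact_mod_cast hℓprime.ne_zero) rfl
  have hTp : ∀ P : geomTorsion (W.baseChange K) p, p • P = 0 := fun P ↦ by
    have := (mem_geomTorsion_iff (W.baseChange K) p _).mp P.2
    apply Subtype.ext
    rw [AddSubgroupClass.coe_nsmul, ← natCast_zsmul]
    exact this
  have hcardK : Nat.card (geomTorsion (W.baseChange K) p) = p ^ 2 :=
    card_torsionPoints_eq_sq_holds (W.baseChange K) (AlgebraicClosure K)
      (by exact_mod_cast hp.ne_zero)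
  -- ### Step 1: the Frobenius data of (3.2)
  obtain ⟨v, 𝔓₀, h, c₀, hℓv, h𝔓₀, hh, hc₀, hE, hKact⟩ := hℓ.2.2.2.2.2
  have hHi := index_range_absGaloisRestrict_eq_finrank ℚ K
  haveI hHn : ((absGaloisRestrict ℚ K).range).Normal :=
    Subgroup.normal_of_index_eq_two (hHi.trans hK.1)
  -- the copy `e₀ : K → ℚ̄` of `K` inside `ℚ̄`; `γ ∈ res(Γ_K)` iff `γ` fixes it pointwise
  set e₀ : K →ₐ[ℚ] AlgebraicClosure ℚ :=
    (absClosureEquiv ℚ K).symm.toAlgHom.comp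
      (IsScalarTower.toAlgHom ℚ K (AlgebraicClosure K)) with he₀
  have he₀x : ∀ x : K, e₀ x = (absClosureEquiv ℚ K).symm (algebraMap K (AlgebraicClosure K) x) :=
    fun _ ↦ rfl
  have hrange : ∀ γ : absoluteGaloisGroup ℚ,
      γ ∈ Set.range (absGaloisRestrict ℚ K) ↔ ∀ x : K, γ • e₀ x = e₀ x := fun γ ↦ by
    rw [mem_range_absGaloisRestrict_iff]
    refine forall_congr' fun x ↦ ?_
    rw [absGaloisTransport_apply, he₀x]
    constructor
    · intro h1
      apply (absClosureEquiv ℚ K).injective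
      rw [AlgEquiv.apply_symm_apply]
      exact h1
    · intro h1
      rw [h1, AlgEquiv.apply_symm_apply]
  have hc₀H : c₀ ∉ Set.range (absGaloisRestrict ℚ K) :=
    hc₀.not_mem_range_absGaloisRestrict (L := K) IsTotallyComplex.isComplex
  have hhH : h ∉ (absGaloisRestrict ℚ K).range := by
    intro hmem
    have hmem' : h ∈ Set.range (absGaloisRestrict ℚ K) := hmem
    apply hc₀H
    rw [hrange]
    intro x
    rw [← hKact e₀ x]
    exact (hrange h).mp hmem' x
  -- ### Step 2: `ℓ` unramified; the prime `𝔔 ∣ λ` and the Frobenius `τ'` with `res τ' = h²`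
  have hunr : Algebra.IsUnramifiedIn (𝓞 K) v.asIdeal :=
    isUnramifiedIn_of_span_natCast_isPrime hℓprime hℓ.2.2.2.2.1 hℓv
  have hIr := inertia_le_range_absGaloisRestrict_of_isUnramifiedIn (K := K) hunr h𝔓₀
  obtain ⟨w', 𝔔, τ', hw'v, -, -, h𝔔w, h𝔔𝔓₀, hτ', hresτ'⟩ :=
    exists_place_inert_of_not_mem_range (F := ℚ) (M := K) (hK.1 ▸ Nat.prime_two) hHn
      (hHi.trans rfl) hunr h𝔓₀ hIr hh hhH
  have hℓw' : (ℓ : 𝓞 K) ∈ w'.asIdeal := by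
    have h1 : (ℓ : 𝓞 ℚ) ∈ (w'.under (𝓞 ℚ)).asIdeal := by rw [hw'v]; exact hℓv
    rw [HeightOneSpectrum.under_asIdeal, Ideal.under_def, Ideal.mem_comap, map_natCast] at h1
    exact h1
  have hw'w : w' = w := hℓ.mem_iff.mp hℓw'
  subst hw'w
  rw [hK.1] at hresτ'
  haveI : 𝔔.IsPrime := h𝔔w.1
  -- ### Step 3: `τ'` fixes `E_p` (`res τ' = h²`, `h` acts on `E_p` as `c₀`, `c₀² = 1`)
  have hτ'fix : τ' ∈ torsionFixing (W.baseChange K) p := by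
    rw [mem_torsionFixing_iff]
    intro Q
    obtain ⟨P, rfl⟩ := (RatClosure.torsionEquiv (K := K) W (p : ℤ)).surjective Q
    rw [← RatClosure.torsionEquiv_smul W p τ' P, hresτ', pow_two, mul_smul, hE, hE,
      ← mul_smul, ← pow_two, hc₀.sq_eq_one, one_smul]
  -- ### Step 6 (part): inertia at `𝔔` fixes `E_p` (good reduction, `λ ∤ p`)
  have hIfix : 𝔔.inertia (absoluteGaloisGroup K) ≤ torsionFixing (W.baseChange K) p :=
    fun i hi ↦ (mem_torsionFixing_iff _ _).mpr fun P ↦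
      (W.baseChange K).smul_geomTorsion_eq_of_mem_inertia hgood hpw h𝔔w hi P
  -- the root `z = ℓ^{1/p}` of the tame factorization
  obtain ⟨z, hz⟩ := IsAlgClosed.exists_pow_nat_eq (algebraMap K (AlgebraicClosure K) (ℓ : K)) hp.pos
  -- ### Step 7: the tame homomorphism `a = [d, ·]|_{I_𝔔}`: non-zero, cyclic image
  set a : 𝔔.inertia (absoluteGaloisGroup K) → geomTorsion (W.baseChange K) p :=
    fun σ ↦ h1Eval (W.baseChange K) p d σ with ha
  have hac : Continuous a := (continuous_h1Eval _ _ d).comp continuous_subtype_val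
  have haa : ∀ σ τ, a (σ * τ) = a σ + a τ := fun σ τ ↦
    h1Eval_mul (W.baseChange K) p d (hIfix σ.2) τ
  -- (7.1): `d_λ ≠ 0` gives a non-zero tame value
  have hd0 : ∃ σ₀ : 𝔔.inertia (absoluteGaloisGroup K), a σ₀ ≠ 0 := by
    by_contra hall
    push Not at hall
    apply hdv
    rw [← oneCocycleClass_reprCocycle (W.baseChange K) p d]
    exact ((W.baseChange K).oneCocycleClass_mem_selmerLocalKer_iff hgood hpw h𝔔w
      (reprCocycle (W.baseChange K) p d)).mpr fun τ hτ ↦ hall ⟨τ, hτ⟩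
  -- cyclicity of `a(I_𝔔)` (tame factorization through `θ_z`)
  haveI : Finite (geomTorsion (W.baseChange K) p) := Nat.finite_of_card_ne_zero (by
    rw [hcardK]; exact pow_ne_zero 2 hp.ne_zero)
  obtain ⟨σ₁, -, hgen⟩ :=
    InertiaTame.exists_forall_apply_eq_nsmul w hp.pos hpw' hπ hz h𝔔w hTp a hac haa
  have hx₀ : a σ₁ ≠ 0 := by
    obtain ⟨σ₀, hσ₀⟩ := hd0
    intro h0
    apply hσ₀
    obtain ⟨k, hk⟩ := hgen σ₀
    rw [hk, h0, smul_zero]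
  -- `fn`-transported tame values: `[H¹(fn) d, σ] = fn [d, σ]`
  have ha' : ∀ σ : 𝔔.inertia (absoluteGaloisGroup K),
      h1Eval (W.baseChange K) p (resH1Hom (ContinuousMonoidHom.id _) fn hfn d) σ = fn (a σ) :=
    fun σ ↦ h1Eval_resH1Hom_id (W.baseChange K) p fn hfn d (hIfix σ.2)
  -- ### Step 8 (NEW): `[s, τ'] ∈ ℤ·t ∩ ℤ·(fn t) = 0`, `t = a σ₁`
  set x := h1Eval (W.baseChange K) p s τ' with hxdef
  have hfx₀ : fn (a σ₁) ≠ 0 := fun h0 ↦ hx₀ (hnoeig _ 0 (by rw [h0, zero_zsmul]))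
  have hRx : e x (a σ₁) = 0 := hR 𝔔 h𝔔w τ' hτ' hτ'fix σ₁ σ₁.2
  have hRx' : e x (fn (a σ₁)) = 0 := by
    rw [← ha' σ₁]; exact hR' 𝔔 h𝔔w τ' hτ' hτ'fix σ₁ σ₁.2
  have hmem : x ∈ AddSubgroup.zmultiples (a σ₁) :=
    mem_zmultiples_of_pairing_eq_zero hcardK hTp e halt hnd hx₀ hRx
  have hmem' : x ∈ AddSubgroup.zmultiples (fn (a σ₁)) :=
    mem_zmultiples_of_pairing_eq_zero hcardK hTp e halt hnd hfx₀ hRx'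
  have hx0 : x = 0 := eq_zero_of_mem_zmultiples_of_noEigenvector hp hTp fn hnoeig hmem hmem'
  -- ### Step 9: Gross's Prop. 9.6 at `λ`: `s_λ = 0 ⟺ [s, Frob] = 0`
  haveI : CharZero (w.adicCompletion K) :=
    charZero_of_injective_algebraMap (algebraMap K (w.adicCompletion K)).injective
  obtain ⟨𝔐, h𝔐⟩ := w.localPrimesAbove_nonempty
  set 𝔓w := w.primeBelow (closureEmb (K := K) (w.adicCompletion K)) 𝔐 with h𝔓wdef
  have h𝔓w : 𝔓w ∈ w.primesAbove := HeightOneSpectrum.primeBelow_mem_primesAbove h𝔐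
  obtain ⟨δ, -, hF⟩ :=
    HeightOneSpectrum.exists_isArithFrobAt_conj_of_mem_primesAbove_holds h𝔔w h𝔓w hτ'
  have hFT : δ * τ' * δ⁻¹ ∈ torsionFixing (W.baseChange K) p :=
    (torsionFixing_normal (W.baseChange K) p).conj_mem _ hτ'fix δ
  have hsunr : s ∈ unramifiedKer (geomTorsion (W.baseChange K) p) 𝔓w :=
    selmerLocalKer_le_unramifiedKer (HeightOneSpectrum.exists_mem_inertia_apply_eq_holds w)
      (W.baseChange K).smul_localPoints_eq_of_mem_inertia_holds hwbad hpw h𝔓w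
      (((mem_selmerGroup_iff (W.baseChange K) p s).mp hs).1 w)
  have hcrit := mem_torsionLocalKer_iff_h1Eval_eq_zero (W.baseChange K) (p : ℤ) h𝔐 hF hFT
    (inertia_le_torsionFixing (W.baseChange K) hwbad hpw _ h𝔐)
    (isOpen_torsionFixing (W.baseChange K) hp0)
    (torsionPointsMap_bijective (W.baseChange K) (w.adicCompletion K) hp.ne_zero).2 hsunr
  rw [hcrit, h1Eval_conj (W.baseChange K) p s δ hτ'fix, ← hxdef, hx0, smul_zero]
end Main

end Summit.BirchSwinnertonDyer.BirchSwinnertonDyer.Theorems.SylvesterTwoCoupledDuality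

end
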